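import Summits.QuantumFields.BalabanUV.Beta.LagrangeFoldLegged

/-!
# `BalabanUV.Beta.LagrangeFoldComb` — binder row D1, RULING R-D1-g35-1 (chart (III′)), brick P4c-W-iv (part 2 of 2): **ORDER-ONE CONSISTENCY (c1)′ OF THE COMB CHART IS A
# THEOREM** — the Λ-fold through `G′_j = GcombSh Lc j` holds for the slot tables `SrecOf V H (GcombSh Lc) …` EXACTLY AS TYPED (raw Λ-coefficients), every level

HONEST FRAMING (cell contract, verbatim): «discharging `BetaPertH` makes Bałaban's UV stability UNCONDITIONAL — a real constructive-QFT
result; it is NOT the continuum limit and NOT the Clay problem.»  HONEST DEPENDENCY: continuum YM on T⁴ ⇐ BetaPertH ∧ nine spine estimates (0/9 proved);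
BetaPertH ⇐ (D1) ∧ (D4) ∧ CAP+tail; G-an2-4 gates asym, D1 and NE2/3/4.
DERIVED cell leaf ([folklore] kernel bookkeeping BY NAME; β sub-cell, BINDER-OWNERS row D1 OWNER `b2b-balaban-beta-an2` gen 36).  No statement of Bałaban's papers,
no `[cite:]`, no `Prop` fact, no `def`.  Discharges NO binder by itself (it closes the located socket (c1)′ displayed as a hypothesis in `WardLocusCombSecondOrder` ∕
`CombChartJointEndTables`); RECORD = ROOT M′ p303989 (chart (II)) unchanged; NOT D1, NOT `BetaPertH`, NOT continuum, NOT Clay.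
CONTENT (part 1 `LagrangeFoldLegged`: legged sandwiches §1 + `lamCoeffK_Gsym_E2`∕`lamCoeffK_Gsym_H0` §3).  §4 the comb-chart Λ-fold with the RAW coefficients of `SrecOf`
(`vertexOfK_lagrangePiece_comb_succ`∕`_zero`: rewrite the raw coefficient into the legged one, `LagrangeFold.vertexOfK_smul_SLam_lamCoeffK`, part 1 §1); §5 with the weights of
`SrecOf` the Λ-sector is the multiplier-column vertex of `M1Of H cΛ`; §6 **(c1)′ `dM_SpureRecOf_M1Of_eq_vertexOfK_SrecOf_comb`**:
`dM (GcombSh Lc j) Lc (SpureRecOf d Lc V H (GcombSh Lc) cE cVH cΛ j) (M1Of d Lc H cΛ j) μ y = vertexOfK (GcombSh Lc j) Lc (SrecOf d Lc V H (GcombSh Lc) cE cVH cΛ j) μ y` for every (LV) border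
table and (LH) constraint-Hessian table, every level (literally `LagrangeFoldSym` §4 with `Gsym ↦ GcombSh`), and the literal corollary **`dM_SpureCombOf_M1Of_eq_vertexOfK_ScombOf`** for
P3's `ScombOf`∕`SpureCombOf` (`CombChartStepJets`) under (M-H) `M = M1Of d Lc tabs.H cΛ`.  an3 g83 W-an3-g83-1 (W1.2) predicted the positive answer.
Provenance: β sub-cell, unit beta-an2 gen 36, 2026-08-22 (v1); over `LagrangeFoldLegged` (this gen), `LagrangeFoldSym`∕`LagrangeFoldZero`∕`LagrangeFold`, `SpineRooted`,
`ChartConjugationReflection` (`vertexOfK_add`), `CombChartStepJets` BY NAME; no existing file touched.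
-/

noncomputable section

open Finset
open scoped BigOperators
open Literature.Probability.LatticeModels (Torus.proj)
open Literature.MathematicalPhysics.QuantumFieldTheory
open Literature.MathematicalPhysics.QuantumFieldTheory.Balaban1983to89
open Literature.MathematicalPhysics.QuantumFieldTheory.Balaban1983to89.Beta
open ExpKernelCalculus (MKer Decays VertexFamily comp)
open KernelWard (bdd_of_decays bdd_of_biLoc)
open AffineAveraging (box toSite codiff₁)
open AveragingContoursRooted (ctr ctrOff ctrOff_mem_box)
open OneStepResolventKernel (Fib KInv LocStencil decays_mono)
open OneStepKernelFamily (KInvStep decays_KInvStep colH vertexOfK)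
open InterLevelTransport (SLam cwsum cwsum_apply)
open BalabanStepJets (lamCoeffOf)
open BalabanStepJetsSucc (lamCoeffK E2 wVH wΛ decays_E2 decays_comp)
open BalabanStepW2 (wM1)
open KernelSpecInstance (wΦ)
open SecondOrderResponse (colM vertexOfM dM)
open Summit.QuantumFields.BalabanUV.Beta.TameKernelCalculus
open Summit.QuantumFields.BalabanUV.Beta.AxialDressingRooted (one_le_of_neZero)
open Summit.QuantumFields.BalabanUV.Beta.BorderedHessian (bhK bhK_inr_inr bhKAt bhKAt_inl_inl decays_bhK bhKStep bhKStep_zero bhKStep_succ_inl_inl spr_bhKStep KInvStep_zero_eq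
  E2_inl_inl_eq_wΦ E2_inl_inr E2_inr exists_abs_wΦ_le codiff₁_wΦ_shift spr_KInvStep)
open Summit.QuantumFields.BalabanUV.Beta.ChartConjugationReflection (vertexOfK_add abs_le_of_locStencil)
open Summit.QuantumFields.BalabanUV.Beta.ChartConjugationRelative (spr_comp)
open Summit.QuantumFields.BalabanUV.Beta.LagrangeFold (vertexOfK_smul_SLam_lamCoeffK E2_inr_col)
open Summit.QuantumFields.BalabanUV.Beta.LagrangeFoldStep (wVH_ne_zero wΛ_eq_wM1_mul_wVH)
open Summit.QuantumFields.BalabanUV.Beta.LagrangeFoldZero (lamCoeffOf_eq_lamCoeffK wM1_zero)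
open Summit.QuantumFields.BalabanUV.Beta.LagrangeFoldMixed (mm_mixed_sandwich_eq_neg)
open Summit.QuantumFields.BalabanUV.Beta.SymmetrisedDressingKernel (piKSymBm piKSymBm_inl_inl piKSymBm_inl_inr piKSymBm_inr_inl piKSymBm_inr_inr coDressKSymAt coDressKSymAt_eq
  comp_piKSymBm_inr spr_piKSymBm spr_trK_piKSymBm)
open Summit.QuantumFields.BalabanUV.Beta.SymBorderedHessianBlind (comp_piKSymBm_bhK)
open Summit.QuantumFields.BalabanUV.Beta.SymBorderedHessianStepBlind (tsum_mul_piKSymBm_inl_inl)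
open Summit.QuantumFields.BalabanUV.Beta.SymmetrisedStepJets (Gsym Gsym_apply decays_Gsym SymTables)
open Summit.QuantumFields.BalabanUV.Beta.SymShiftedSpread (bhKStepSh bhKStepSh_apply spr_bhKStepSh)
open Summit.QuantumFields.BalabanUV.Beta.DshAn1 (Dsh Dsh_inl_inl Dsh_inr_inr spr_Dsh)
open Summit.QuantumFields.BalabanUV.Beta.RelInvFactorSandwich (Gsym_inr_col_coarse comp_Gsym_bhKStepSh_inr_inl spr_Gsym)
open Summit.QuantumFields.BalabanUV.Beta.E3ContactFactor (bhKStepSh_mm)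
open Summit.QuantumFields.BalabanUV.Beta.CombChartStepJets (GcombSh decays_GcombSh ScombOf SpureCombOf ScombOf_eq SpureCombOf_eq)
open Summit.QuantumFields.BalabanUV.Beta.CombChartContactFactor (comp_Gsym_Dsh_inr_inl comp_bhKStepSh_GcombSh_inr_inr GcombSh_inr_inr)
open Summit.QuantumFields.BalabanUV.Beta.SpineRooted (M1Of M1Of_apply SpureRecOf locStencil_SpureRecOf locStencil_SrecOf SrecOf_eq_SpureRecOf_add_lam_zero
  SrecOf_eq_SpureRecOf_add_lam_succ)
open Summit.QuantumFields.BalabanUV.Beta.WardLocusRecursive (SrecOf)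

open Summit.QuantumFields.BalabanUV.Beta.LagrangeFoldLegged (colM_mixed_sandwich_E2_legged colM_mixed_sandwich_zero_legged lamCoeffK_Gsym_E2 lamCoeffK_Gsym_H0)

namespace Summit.QuantumFields.BalabanUV.Beta.LagrangeFoldComb

variable {d Lc : ℕ} [NeZero Lc]

/-! ## §4 The Λ-fold of the comb chart with the RAW coefficients of `SrecOf` -/

/-- [folklore] **LEVEL `j+1`**: for every bounded coarse-bond table `Q`,
`vertexOfK (GcombSh Lc (j+1)) Lc (κ u ↦ c • SLam Lc (lamCoeffK (KInvStep Lc (j+1)) (E2 (j+1)) Lc) Q κ u) μ y = (c ∕ wVH (j+1)) • vertexOfM (GcombSh Lc (j+1)) Lc Q μ y`. -/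
theorem vertexOfK_lagrangePiece_comb_succ (j : ℕ) {Q : Fin (d + 1) → (Fin (d + 1) → ℤ) → MKer (d + 1) (Fib d)} {B : ℝ}
    (hQ : ∀ ρ' w x z a b, |Q ρ' w x z a b| ≤ B) (c : ℝ) (μ : Fin (d + 1)) (y : Fin (d + 1) → ℤ) :
    vertexOfK (GcombSh (d := d) Lc (j + 1)) Lc (fun κ u => c • SLam Lc (lamCoeffK (KInvStep (d := d) Lc (j + 1)) (E2 d Lc (j + 1)) Lc) Q κ u) μ y
      = (c / wVH d Lc (j + 1)) • vertexOfM (GcombSh (d := d) Lc (j + 1)) Lc Q μ y := by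
  rw [← lamCoeffK_Gsym_E2 (j + 1)]
  have hG := decays_GcombSh (d := d) Lc (j + 1)
  have hAE : ∃ δ C : ℝ, 0 < δ ∧ 0 ≤ C ∧ Decays (comp (Gsym (d := d) Lc (j + 1)) (E2 d Lc (j + 1))) C δ := by
    obtain ⟨δ₁, C₁, hδ₁, hC₁, h₁⟩ := decays_Gsym (d := d) Lc (j + 1)
    obtain ⟨δ₂, C₂, hδ₂, hC₂, h₂⟩ := decays_E2 (d := d) (Lc := Lc) (j + 1)
    have h₁' : Decays (Gsym (d := d) Lc (j + 1)) C₁ (min δ₁ δ₂) := decays_mono h₁ hC₁ le_rfl (min_le_left _ _)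
    have h₂' : Decays (E2 d Lc (j + 1)) C₂ (min δ₁ δ₂) := decays_mono h₂ hC₂ le_rfl (min_le_right _ _)
    have hm : 0 < min δ₁ δ₂ := lt_min hδ₁ hδ₂
    exact ⟨min δ₁ δ₂ / 2, _, half_pos hm, (decays_comp h₁' h₂' (half_pos hm).le (half_lt_self hm)).nonneg (Sum.inl 0),
      decays_comp h₁' h₂' (half_pos hm).le (half_lt_self hm)⟩
  rw [vertexOfK_smul_SLam_lamCoeffK (N := Lc) hG hAE (fun v u h ν => E2_inr_col Lc (j + 1) v u h ν) hQ c μ y]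
  have hM : vertexOfM (comp (comp (Gsym (d := d) Lc (j + 1)) (E2 d Lc (j + 1))) (GcombSh (d := d) Lc (j + 1))) Lc Q μ y
      = -((wVH d Lc (j + 1))⁻¹ • vertexOfM (GcombSh (d := d) Lc (j + 1)) Lc Q μ y) := by
    funext x z a b
    simp only [vertexOfM, cwsum_apply, Pi.neg_apply, Pi.smul_apply, smul_eq_mul, Finset.mul_sum, ← Finset.sum_neg_distrib]
    refine Finset.sum_congr rfl fun ρ' _ => ?_
    rw [← tsum_mul_left, ← tsum_neg]
    refine tsum_congr fun w => ?_
    rw [colM_mixed_sandwich_E2_legged (d := d) (Lc := Lc) j μ y ρ' w]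
    ring
  rw [hM, smul_neg, neg_neg, smul_smul, div_eq_mul_inv]

/-- [folklore] **LEVEL `0`**: for every bounded coarse-bond table `Q`,
`vertexOfK (GcombSh Lc 0) Lc (κ u ↦ c • SLam Lc (lamCoeffOf (KInv Lc) Lc) Q κ u) μ y = c • vertexOfM (GcombSh Lc 0) Lc Q μ y`. -/
theorem vertexOfK_lagrangePiece_comb_zero {Q : Fin (d + 1) → (Fin (d + 1) → ℤ) → MKer (d + 1) (Fib d)} {B : ℝ}
    (hQ : ∀ ρ' w x z a b, |Q ρ' w x z a b| ≤ B) (c : ℝ) (μ : Fin (d + 1)) (y : Fin (d + 1) → ℤ) :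
    vertexOfK (GcombSh (d := d) Lc 0) Lc (fun κ u => c • SLam Lc (lamCoeffOf (KInv (N := Lc) (d := d)) Lc) Q κ u) μ y
      = c • vertexOfM (GcombSh (d := d) Lc 0) Lc Q μ y := by
  have hLc : 1 ≤ Lc := one_le_of_neZero Lc
  set H₀ : MKer (d + 1) (Fib d) := fun x z a b => match a, b with
    | Sum.inl κ, Sum.inl l => bhK (d := d) Lc x z (Sum.inl κ) (Sum.inl l)
    | _, _ => 0 with hH
  -- `H₀` decays (entries dominated by those of `bhK`)
  have hH₀ : ∃ δ C : ℝ, 0 < δ ∧ 0 ≤ C ∧ Decays H₀ C δ := by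
    have hMd := decays_bhK (d := d) hLc (show (0 : ℝ) ≤ 1 from zero_le_one)
    refine ⟨1, _, one_pos, hMd.nonneg (Sum.inl 0), fun x z a b => ?_⟩
    rcases a with κ | ν <;> rcases b with l | ν'
    · exact hMd x z (Sum.inl κ) (Sum.inl l)
    all_goals
      simp only [hH, abs_zero]
      exact (abs_nonneg _).trans (hMd x z (Sum.inl 0) (Sum.inl 0))
  have hHspr : Spr H₀ := by
    obtain ⟨δ, C, hδ, _, h⟩ := hH₀
    exact ⟨C, δ, hδ, h⟩
  have hcoef : lamCoeffOf (KInv (N := Lc) (d := d)) Lc = lamCoeffK (Gsym (d := d) Lc 0) H₀ Lc := by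
    rw [lamCoeffK_Gsym_H0 hHspr (fun x z κ l => rfl) (fun x z κ ν => rfl) (fun x z ν b => by cases b <;> rfl), KInvStep_zero_eq]
    funext μ' y' κ' u'
    exact lamCoeffOf_eq_lamCoeffK (ctr (d + 1) Lc) (KInv (N := Lc) (d := d)) H₀ (fun x z κ l => by rw [hH, bhKAt_inl_inl])
      (fun x z ν l => rfl) μ' y' κ' u'
  have hG := decays_GcombSh (d := d) Lc 0
  have hAE : ∃ δ C : ℝ, 0 < δ ∧ 0 ≤ C ∧ Decays (comp (Gsym (d := d) Lc 0) H₀) C δ := by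
    obtain ⟨δ₁, C₁, hδ₁, hC₁, h₁⟩ := decays_Gsym (d := d) Lc 0
    obtain ⟨δ₂, C₂, hδ₂, hC₂, h₂⟩ := hH₀
    have h₁' : Decays (Gsym (d := d) Lc 0) C₁ (min δ₁ δ₂) := decays_mono h₁ hC₁ le_rfl (min_le_left _ _)
    have h₂' : Decays H₀ C₂ (min δ₁ δ₂) := decays_mono h₂ hC₂ le_rfl (min_le_right _ _)
    have hm : 0 < min δ₁ δ₂ := lt_min hδ₁ hδ₂
    exact ⟨min δ₁ δ₂ / 2, _, half_pos hm, (decays_comp h₁' h₂' (half_pos hm).le (half_lt_self hm)).nonneg (Sum.inl 0),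
      decays_comp h₁' h₂' (half_pos hm).le (half_lt_self hm)⟩
  have hE : ∀ v u (h : Fib d) (ν : Fin (d + 1)), H₀ v u h (Sum.inr ν) = 0 := fun v u h ν => by cases h <;> rfl
  rw [hcoef, vertexOfK_smul_SLam_lamCoeffK (N := Lc) hG hAE hE hQ c μ y]
  have hM : vertexOfM (comp (comp (Gsym (d := d) Lc 0) H₀) (GcombSh (d := d) Lc 0)) Lc Q μ y = -vertexOfM (GcombSh (d := d) Lc 0) Lc Q μ y := by
    funext x z a b
    simp only [vertexOfM, cwsum_apply, Pi.neg_apply, ← Finset.sum_neg_distrib, ← tsum_neg]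
    refine Finset.sum_congr rfl fun ρ' _ => tsum_congr fun w => ?_
    rw [colM_mixed_sandwich_zero_legged (d := d) (Lc := Lc) (H₀ := H₀) (fun x z κ l => rfl) (fun x z κ ν => rfl) (fun x z ν l => rfl)
      (fun x z ν ν' => rfl) μ y ρ' w]
    ring
  rw [hM, smul_neg, neg_neg]

/-! ## §5 With the weights of `SrecOf`: the Λ-sector is the multiplier-column vertex of `M1Of H cΛ` -/

/-- [folklore] **LEVEL `j+1`**: `vertexOfK (GcombSh Lc (j+1)) Lc (κ u ↦ (cΛ·wΛ (j+1)) • SLam Lc (lamCoeffK (KInvStep Lc (j+1)) (E2 (j+1)) Lc) H κ u) μ y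
= vertexOfM (GcombSh Lc (j+1)) Lc (M1Of d Lc H cΛ (j+1)) μ y` for every bounded table `H`. -/
theorem vertexOfK_lagrangePiece_comb_eq_M1Of_succ (j : ℕ) {H : Fin (d + 1) → (Fin (d + 1) → ℤ) → MKer (d + 1) (Fib d)} {B : ℝ}
    (hH : ∀ ρ' w x z a b, |H ρ' w x z a b| ≤ B) (cΛ : ℝ) (μ : Fin (d + 1)) (y : Fin (d + 1) → ℤ) :
    vertexOfK (GcombSh (d := d) Lc (j + 1)) Lc
        (fun κ u => (cΛ * wΛ d Lc (j + 1)) • SLam Lc (lamCoeffK (KInvStep (d := d) Lc (j + 1)) (E2 d Lc (j + 1)) Lc) H κ u) μ y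
      = vertexOfM (GcombSh (d := d) Lc (j + 1)) Lc (M1Of d Lc H cΛ (j + 1)) μ y := by
  rw [vertexOfK_lagrangePiece_comb_succ j hH _ μ y]
  have hw : wVH d Lc (j + 1) ≠ 0 := wVH_ne_zero (j + 1)
  have hc : cΛ * wΛ d Lc (j + 1) / wVH d Lc (j + 1) = cΛ * wM1 d Lc (j + 1) := by
    rw [wΛ_eq_wM1_mul_wVH]; field_simp
  rw [hc]
  funext x z a b
  simp only [Pi.smul_apply, smul_eq_mul, vertexOfM, cwsum_apply, M1Of_apply, Finset.mul_sum]
  refine Finset.sum_congr rfl fun ρ' _ => ?_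
  rw [← tsum_mul_left]
  exact tsum_congr fun w => by ring

/-- [folklore] **LEVEL `0`**: `vertexOfK (GcombSh Lc 0) Lc (κ u ↦ cΛ • SLam Lc (lamCoeffOf (KInv Lc) Lc) H κ u) μ y = vertexOfM (GcombSh Lc 0) Lc (M1Of d Lc H cΛ 0) μ y`. -/
theorem vertexOfK_lagrangePiece_comb_eq_M1Of_zero {H : Fin (d + 1) → (Fin (d + 1) → ℤ) → MKer (d + 1) (Fib d)} {B : ℝ}
    (hH : ∀ ρ' w x z a b, |H ρ' w x z a b| ≤ B) (cΛ : ℝ) (μ : Fin (d + 1)) (y : Fin (d + 1) → ℤ) :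
    vertexOfK (GcombSh (d := d) Lc 0) Lc (fun κ u => cΛ • SLam Lc (lamCoeffOf (KInv (N := Lc) (d := d)) Lc) H κ u) μ y
      = vertexOfM (GcombSh (d := d) Lc 0) Lc (M1Of d Lc H cΛ 0) μ y := by
  rw [vertexOfK_lagrangePiece_comb_zero hH cΛ μ y]
  funext x z a b
  simp only [Pi.smul_apply, smul_eq_mul, vertexOfM, cwsum_apply, M1Of_apply, wM1_zero, mul_one, Finset.mul_sum]
  refine Finset.sum_congr rfl fun ρ' _ => ?_
  rw [← tsum_mul_left]
  exact tsum_congr fun w => by ring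

/-! ## §6 (c1)′ — order-one consistency at the comb-chart resolvents, every level -/

/-- **(c1)′ — ORDER-ONE CONSISTENCY AT THE COMB-CHART RESOLVENTS FOR THE SLOTTED FIRST-ORDER TABLES, EVERY LEVEL**: for any border table `V` with (LV), any
constraint-Hessian table `H` with (LH), and the multiplier tables `M1Of d Lc H cΛ`:
`dM (GcombSh Lc j) Lc (SpureRecOf d Lc V H (GcombSh Lc) cE cVH cΛ j) (M1Of d Lc H cΛ j) μ y = vertexOfK (GcombSh Lc j) Lc (SrecOf d Lc V H (GcombSh Lc) cE cVH cΛ j) μ y`. [folklore] -/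
theorem dM_SpureRecOf_M1Of_eq_vertexOfK_SrecOf_comb {V H : Fin (d + 1) → (Fin (d + 1) → ℤ) → MKer (d + 1) (Fib d)}
    (hV : ∀ δ : ℝ, 0 ≤ δ → ∃ C : ℝ, LocStencil V C δ) (hH : ∀ δ : ℝ, 0 ≤ δ → ∃ C : ℝ, VertexFamily H Lc C δ) (cE cVH cΛ : ℝ) :
    ∀ (j : ℕ) (μ : Fin (d + 1)) (y : Fin (d + 1) → ℤ),
      dM (GcombSh (d := d) Lc j) Lc (SpureRecOf d Lc V H (GcombSh Lc) cE cVH cΛ j) (M1Of d Lc H cΛ j) μ y =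
        vertexOfK (GcombSh (d := d) Lc j) Lc (SrecOf d Lc V H (GcombSh Lc) cE cVH cΛ j) μ y := by
  have hLc : 1 ≤ Lc := one_le_of_neZero Lc
  obtain ⟨CH, hHv⟩ := hH 0 le_rfl
  have hHb : ∀ ρ' w x z a b, |H ρ' w x z a b| ≤ CH := fun ρ' w x z a b => bdd_of_biLoc (hHv ρ' w) le_rfl x z a b
  intro j μ y
  obtain ⟨Cs, δs, hδs, hS⟩ := locStencil_SpureRecOf (d := d) hLc hV hH (decays_GcombSh Lc) cE cVH cΛ j
  obtain ⟨Cf, δf, hδf, hF⟩ := locStencil_SrecOf (d := d) hLc hV hH (decays_GcombSh Lc) cE cVH cΛ j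
  have hSb : ∀ κ' u x z a b, |SpureRecOf d Lc V H (GcombSh Lc) cE cVH cΛ j κ' u x z a b| ≤ max Cs (Cs + Cf) :=
    fun κ' u x z a b => (abs_le_of_locStencil hS hδs.le κ' u x z a b).trans (le_max_left _ _)
  rcases j with _ | j
  · set PΛ : Fin (d + 1) → (Fin (d + 1) → ℤ) → MKer (d + 1) (Fib d) := fun κ' u' =>
      cΛ • SLam Lc (lamCoeffOf (KInv (N := Lc) (d := d)) Lc) H κ' u' with hPΛ
    have e : SrecOf d Lc V H (GcombSh Lc) cE cVH cΛ 0 = fun κ' u' => SpureRecOf d Lc V H (GcombSh Lc) cE cVH cΛ 0 κ' u' + PΛ κ' u' := by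
      funext κ' u'; exact SrecOf_eq_SpureRecOf_add_lam_zero V H (GcombSh Lc) cE cVH cΛ κ' u'
    have hΛb : ∀ κ' u x z a b, |PΛ κ' u x z a b| ≤ max Cs (Cs + Cf) := by
      intro κ' u x z a b
      have h1 : PΛ κ' u x z a b = SrecOf d Lc V H (GcombSh Lc) cE cVH cΛ 0 κ' u x z a b - SpureRecOf d Lc V H (GcombSh Lc) cE cVH cΛ 0 κ' u x z a b := by
        rw [e]; simp only [Pi.add_apply]; ring
      rw [h1]
      refine (abs_sub _ _).trans ((add_le_add (abs_le_of_locStencil hF hδf.le κ' u x z a b) (abs_le_of_locStencil hS hδs.le κ' u x z a b)).trans ?_)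
      rw [add_comm]; exact le_max_right _ _
    rw [e, vertexOfK_add (decays_GcombSh (d := d) Lc 0) hSb hΛb, SecondOrderResponse.dM]
    congr 1
    exact (vertexOfK_lagrangePiece_comb_eq_M1Of_zero hHb cΛ μ y).symm
  · set PΛ : Fin (d + 1) → (Fin (d + 1) → ℤ) → MKer (d + 1) (Fib d) := fun κ' u' =>
      (cΛ * wΛ d Lc (j + 1)) • SLam Lc (lamCoeffK (KInvStep (d := d) Lc (j + 1)) (E2 d Lc (j + 1)) Lc) H κ' u' with hPΛ
    have e : SrecOf d Lc V H (GcombSh Lc) cE cVH cΛ (j + 1) =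
        fun κ' u' => SpureRecOf d Lc V H (GcombSh Lc) cE cVH cΛ (j + 1) κ' u' + PΛ κ' u' := by
      funext κ' u'; exact SrecOf_eq_SpureRecOf_add_lam_succ V H (GcombSh Lc) cE cVH cΛ j κ' u'
    have hΛb : ∀ κ' u x z a b, |PΛ κ' u x z a b| ≤ max Cs (Cs + Cf) := by
      intro κ' u x z a b
      have h1 : PΛ κ' u x z a b = SrecOf d Lc V H (GcombSh Lc) cE cVH cΛ (j + 1) κ' u x z a b -
          SpureRecOf d Lc V H (GcombSh Lc) cE cVH cΛ (j + 1) κ' u x z a b := by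
        rw [e]; simp only [Pi.add_apply]; ring
      rw [h1]
      refine (abs_sub _ _).trans ((add_le_add (abs_le_of_locStencil hF hδf.le κ' u x z a b) (abs_le_of_locStencil hS hδs.le κ' u x z a b)).trans ?_)
      rw [add_comm]; exact le_max_right _ _
    rw [e, vertexOfK_add (decays_GcombSh (d := d) Lc (j + 1)) hSb hΛb, SecondOrderResponse.dM]
    congr 1
    exact (vertexOfK_lagrangePiece_comb_eq_M1Of_succ j hHb cΛ μ y).symm

/-- **(c1)′ FOR THE CHART-(III′) LITERAL's FIRST-ORDER TABLES (P3, `CombChartStepJets`)**: for every table record `tabs : SymTables d Lc` and the multiplier tables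
`M1Of d Lc tabs.H cΛ` ((M-H)), `dM (GcombSh Lc j) Lc (SpureCombOf tabs cE cVH cΛ j) (M1Of d Lc tabs.H cΛ j) μ y = vertexOfK (GcombSh Lc j) Lc (ScombOf tabs cE cVH cΛ j) μ y`,
every level. [folklore] -/
theorem dM_SpureCombOf_M1Of_eq_vertexOfK_ScombOf (tabs : SymTables d Lc) (cE cVH cΛ : ℝ) (j : ℕ) (μ : Fin (d + 1)) (y : Fin (d + 1) → ℤ) :
    dM (GcombSh (d := d) Lc j) Lc (SpureCombOf tabs cE cVH cΛ j) (M1Of d Lc tabs.H cΛ j) μ y =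
      vertexOfK (GcombSh (d := d) Lc j) Lc (ScombOf tabs cE cVH cΛ j) μ y := by
  rw [ScombOf_eq, SpureCombOf_eq]
  exact dM_SpureRecOf_M1Of_eq_vertexOfK_SrecOf_comb tabs.hV tabs.hH cE cVH cΛ j μ y

end Summit.QuantumFields.BalabanUV.Beta.LagrangeFoldComb

end
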